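import Literature.NumberTheory.Sieve.FordMaynardLevelHalfSieve
import Literature.NumberTheory.Sieve.FordMaynardFramework
import Literature.NumberTheory.Sieve.FordMaynardFragmentation
import HarnessLib

/-!
# Ford–Maynard, Theorem 7.3 (a) (sieve lower bounds from a function `g` on `𝒢₁`) at
# `P = (1/2, 0, ν)`, `0 < ν < 1/4` — the statement layer (named fact)

K. Ford, J. Maynard, *On the theory of prime producing sieves*, arXiv:2407.14368v1 (2024), §7.1.
This is the POSITIVE engine of the paper (the negative engine, Theorems 6.3/6.4/9.1, is proved in the
tree: `FordMaynardConstruction.lean`, `FordMaynardFragmentation*.lean`, `FordMaynardPrimeFreeOfTypeIStar*.lean`).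
We vendor it as ONE named fact, specialised to the family `P_ν = (γ, θ, ν) = (1/2, 0, ν)` with
`0 < ν < 1/4` (the range of Theorem 2.7 (b) and of the parity-ideate cell's certified `g`), with the sets
`ℋ(P)`, `𝒢₁(P)` made explicit, over the tree's transcription `IsLowerSieveConst` of Definition 4.8 —
exactly the shape a certified piecewise-constant `g` needs to become `∃ c > 0, IsLowerSieveConst (1/2) 0 ν c`.

## The printed statements (verbatim, TeX lightly transliterated)

* (7.1), p. 27: `ℋ = ℋ(P) := {x ∈ 𝒞(ℛ) : xᵢ ≥ ν ∀ i, at least two components}`,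
  `𝒵 := {y : y is a subvector of a vector x ∈ 𝒞(ℛ)}`,
  `ψ(x) := sup{|ξ| : ξᵢ < ν ∀ i, (x, ξ) ∈ 𝒵}`,
  `𝒢₁ := {x ∈ 𝒵 : xᵢ ≥ ν ∀ i; |x| + ψ(x) ≤ γ}`, `𝒢₂ := {x ∈ 𝒵 : xᵢ ≥ ν ∀ i; |x| + ψ(x) > γ, |x| ≤ γ}`.
* Definition 7.1: `(𝟙⋆g)(x) = ∑_{y ⊆ x} g(y)` (sum over all `2^{dim x}` subvectors).
* Definition 7.2: "Let `𝒮𝒢₁` denote the set of all vector functions in `𝒮`, supported on `𝒢₁` that are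
  finite sums of functions which are each bounded, supported on a convex polytope which lies in
  `{x ∈ ℝ^k : 0 ≤ x₁ ≤ ⋯ ≤ x_k}` for some `k`, and with bounded, continuous first order partial
  derivatives on the interior of the polytope."
* **Theorem 7.3 (Sieve bounds, `𝒢₁` only version).** "Suppose that `(γ,θ,ν) ∈ 𝒬₀` and that `ℛ` is
  nonempty. Let `g ∈ 𝒮𝒢₁` satisfy `g(∅) = 1`. (a) If `(𝟙⋆g)(x) ≤ 0` for all `x ∈ ℋ(P)`, then
  `C⁻(γ,θ,ν) ≥ 1 + ∑_{k=2}^{⌊1/ν⌋} ∫_{x ∈ ℋ(P) ∩ ℝ^k, x₁ ≤ ⋯ ≤ x_k} (𝟙⋆g)(x)/(x₁⋯x_k) dx`. (b) …"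
  (integration on the hyperplane `|x| = 1` w.r.t. `dx₁⋯dx_{k−1}`, §4.2).
* **Lemma 8.4.** "Let `0 < ν ≤ 1/3` and `P = (1/2, 0, ν)`. Then
  `ℋ(P) = {x : dim x ≥ 2, |x| = 1, xᵢ ∈ (ν, 1−2ν) ∪ (2ν, 1−ν) ∀ i}`."

## The specialisation (why the fact below is implied by, and weaker than, the printed theorem)

For `P = (1/2, 0, ν)` with `0 < ν < 1/4`: `P ∈ 𝒬₀` and `ℛ(P) = {components in (ν, 1/2), sum 1} ≠ ∅`
(proof of Lemma 8.4). Every component of a vector of `𝒞(ℛ)`, hence of `𝒵`, exceeds `ν`, so `ψ ≡ 0` on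
`𝒵` and `𝒢₁ = {x ∈ 𝒵 : |x| ≤ 1/2}`; the set used below, `𝒢₁' = {∅} ∪ {x : all xᵢ > ν, |x| < 1/2}`, is a
SUBSET of `𝒢₁` (for such `x`, `(x, r/2, r/2)` with `r = 1 − |x| > 1/2` lies in `ℛ`, as `r/2 ∈ (1/4, 1/2)`
and `ν < 1/4`), so "supported on `𝒢₁'`" is a stronger hypothesis. By Lemma 8.4 and `2ν < 1 − 2ν`,
`ℋ(P) = {x : dim x ≥ 2, |x| = 1, ν < xᵢ < 1 − ν ∀ i}` exactly. The class `IsPiecewiseConstOnCone` (on the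
ordered cone, `g` is a finite linear combination of indicators of convex polytopes lying in the cone;
`g` symmetric) is contained in `𝒮𝒢₁` (zero partial derivatives). `C⁻(P)` is a supremum of admissible
constants over a class of pairs `(a, b)` containing the pairs `(a, 1)` of `IsLowerSieveConst`, and
admissibility is downward closed in the constant, so "`C⁻(P) ≥ V`" yields `IsLowerSieveConst (1/2) 0 ν c`
for every `c < V`. Nothing else is used. `-- TODO(general form): (γ, θ, ν) ∈ 𝒬₀, general 𝒮𝒢₁, part (b).`

Consumers: the parity-ideate cell's b-side rung (`LowerSieveThresholdAt (1651/10000)`,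
`FordMaynardLevelHalfThresholds.lean`): an LP-optimised piecewise-constant `g` with a certified positive
bound `V`; and a second derivation of the tree's named fact `FordMaynard2024_thm27b` (first clause) from
Ford–Maynard's own `g` of §8 once its three integrals are certified.

## References
* [FordMaynard2024PrimeSieves] K. Ford, J. Maynard, arXiv:2407.14368v1: (7.1) p. 27, Definitions 7.1, 7.2,
  Theorem 7.3 (p. 28), Lemma 8.4 (p. 46), Definitions 4.7–4.8, §4.2 (integration convention).
-/

noncomputable section

open Finset MeasureTheory

namespace Literature.NumberTheory.Sieve.FordMaynard

open Literature.Barriers.Parity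

/-! ### Definition 7.1: `(𝟙 ⋆ g)(x) = ∑_{y ⊆ x} g(y)` -/

/-- **Definition 7.1**, `(𝟙⋆g)(x) = ∑_{y ⊆ x} g(y)`: the sum of `g` over all `2^{dim x}` subvectors of `x`
(index subsets `A ⊆ [k]`, the subvector `x_A` listed in increasing index order; `A = ∅` contributes
`g(∅)`, `A = [k]` contributes `g(x)`). [cite: FordMaynard2024PrimeSieves, Definition 7.1] -/
def starSum (g : VecFn) (k : ℕ) (x : Fin k → ℝ) : ℝ :=
  ∑ A : Finset (Fin k), g A.card (fun i => x (A.orderEmbOfFin rfl i))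

/-! ### Definition 7.2, restricted: piecewise constant on convex polytopes in the ordered cone -/

open scoped Classical in
/-- A sub-class of `𝒮𝒢₁`'s regularity condition (Definition 7.2) sufficient for certified computations:
in each dimension `k`, on the ordered cone `{x₁ ≤ ⋯ ≤ x_k}` the function `g_k` is a finite linear
combination of indicators of convex polytopes (Definition 5.7, `IsConvexPolytope`) lying in that cone —
each piece is bounded, supported on a convex polytope in the cone, with vanishing (hence bounded,
continuous) first-order partials on the interior, as Definition 7.2 requires. Symmetry (`g ∈ 𝒮`) is
imposed separately. [cite: FordMaynard2024PrimeSieves, Definition 7.2 (sub-class)] -/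
def IsPiecewiseConstOnCone (g : VecFn) : Prop :=
  ∀ k : ℕ, ∃ (m : ℕ) (P : Fin m → Set (Fin k → ℝ)) (c : Fin m → ℝ),
    (∀ j, IsConvexPolytope (P j) ∧ P j ⊆ {x | Monotone x}) ∧
      ∀ x : Fin k → ℝ, Monotone x → g k x = ∑ j, if x ∈ P j then c j else 0

/-! ### Theorem 7.3 (a) at `P = (1/2, 0, ν)`, `0 < ν < 1/4` -/

open scoped Classical in
/-- The right-hand side of Theorem 7.3 (a) at `P = (1/2, 0, ν)`, `0 < ν < 1/4`:
`V(ν, g) = 1 + ∑_{k=2}^{⌊1/ν⌋} ∫_{x ∈ ℋ(P) ∩ ℝ^k, x₁ ≤ ⋯ ≤ x_k} (𝟙⋆g)(x)/(x₁⋯x_k) dx` with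
`ℋ(P) ∩ ℝ^k = {x : |x| = 1, ν < xᵢ < 1 − ν}` (Lemma 8.4; `k ≥ 2`) and the hyperplane integral of §4.2
(`sliceIntegral k 1`). [cite: FordMaynard2024PrimeSieves, Theorem 7.3 (a) and Lemma 8.4] -/
def sieveBoundG1 (ν : ℝ) (g : VecFn) : ℝ :=
  1 + ∑ k ∈ Icc 2 ⌊1 / ν⌋₊, sliceIntegral k 1
    (fun x => if (∀ i, ν < x i ∧ x i < 1 - ν) ∧ Monotone x then starSum g k x / ∏ i, x i else 0)

/-- **Ford–Maynard, Theorem 7.3 (a), at `P = (1/2, 0, ν)` with `0 < ν < 1/4`** (named fact; the printed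
theorem is for all `(γ, θ, ν) ∈ 𝒬₀` with `ℛ ≠ ∅` and all `g ∈ 𝒮𝒢₁` — see the module docstring for the
verbatim text and for why this instance is implied by it). Let `g ∈ 𝒮` (symmetric) be piecewise constant
on convex polytopes in the ordered cone (`IsPiecewiseConstOnCone`, a sub-class of `𝒮𝒢₁`), with
`g(∅) = 1`, supported (apart from `∅`) on vectors with all components `> ν` and sum `< 1/2` (a subset of
`𝒢₁(P)`), and suppose `(𝟙⋆g)(x) ≤ 0` for every `x` of dimension `≥ 2` with `|x| = 1` and all
`xᵢ ∈ (ν, 1 − ν)` (`= ℋ(P)` by Lemma 8.4). Then `C⁻(1/2, 0, ν) ≥ V(ν, g) = sieveBoundG1 ν g`, read on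
Definition 4.8 with comparison sequence `1`: every `c < V(ν, g)` is an admissible lower-bound sieve
constant, `IsLowerSieveConst (1/2) 0 ν c`.
WARNING (2026-08-31, `Summits/Parity/GeneralizedHardyLittlewood/Cruxes/FMThm73aLevelHalf/Lines/closed_point.lean`):
with the STRICT support clause `∑ i, x i < 1/2` transcribed here the hypotheses are jointly unsatisfiable for
`ν < 1/4` (at `x = (1/2, 1/2)` the sign hypothesis needs `(𝟙⋆g) ≤ 0` while strict support forces
`(𝟙⋆g)(1/2, 1/2) = g(∅) = 1`), so this decl is VACUOUSLY TRUE; the printed clause is `|x| ≤ 1/2` ((7.1),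
p. 27; p. 47) — use `FordMaynard2024_thm73a_levelHalf_le` below. Kept because it has consumers by name.
[cite: FordMaynard2024PrimeSieves, Theorem 7.3 (a) (with (7.1), Definitions 7.1–7.2, Lemma 8.4)] -/
def FordMaynard2024_thm73a_levelHalf : Prop :=
  ∀ ν : ℝ, 0 < ν → ν < 1 / 4 →
    ∀ g : VecFn, g.IsSymmetric → IsPiecewiseConstOnCone g →
      (∀ e : Fin 0 → ℝ, g 0 e = 1) →
      (∀ (k : ℕ) (x : Fin k → ℝ), g k x ≠ 0 → k = 0 ∨ ((∀ i, ν < x i) ∧ ∑ i, x i < 1 / 2)) →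
      (∀ k : ℕ, 2 ≤ k → ∀ x : Fin k → ℝ, (∀ i, ν < x i ∧ x i < 1 - ν) → ∑ i, x i = 1 →
          starSum g k x ≤ 0) →
        ∀ c : ℝ, c < sieveBoundG1 ν g → IsLowerSieveConst (1 / 2) 0 ν c

/-- How the fact is consumed: a `g` meeting the hypotheses with a POSITIVE bound `V(ν, g) > 0` gives a
positive admissible constant, i.e. `C⁻(1/2, 0, ν) > 0` in the form of `FordMaynard2024_thm27b`'s first
clause / `LowerSieveThresholdAt`. [cite: FordMaynard2024PrimeSieves, Theorem 7.3 (a) (use in the proof of Theorem 2.7 (b), §8)] -/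
theorem FordMaynard2024_thm73a_levelHalf.exists_pos (h : FordMaynard2024_thm73a_levelHalf)
    {ν : ℝ} (hν : 0 < ν) (hν4 : ν < 1 / 4) {g : VecFn} (hs : g.IsSymmetric)
    (hpc : IsPiecewiseConstOnCone g) (h0 : ∀ e : Fin 0 → ℝ, g 0 e = 1)
    (hsupp : ∀ (k : ℕ) (x : Fin k → ℝ), g k x ≠ 0 → k = 0 ∨ ((∀ i, ν < x i) ∧ ∑ i, x i < 1 / 2))
    (hH : ∀ k : ℕ, 2 ≤ k → ∀ x : Fin k → ℝ, (∀ i, ν < x i ∧ x i < 1 - ν) → ∑ i, x i = 1 →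
      starSum g k x ≤ 0)
    (hV : 0 < sieveBoundG1 ν g) :
    ∃ c : ℝ, 0 < c ∧ IsLowerSieveConst (1 / 2) 0 ν c :=
  ⟨sieveBoundG1 ν g / 2, by linarith, h ν hν hν4 g hs hpc h0 hsupp hH _ (by linarith)⟩

/-- **Ford–Maynard, Theorem 7.3 (a), at `P = (1/2, 0, ν)` with `0 < ν < 1/4` — printed support clause.**
Same statement as `FordMaynard2024_thm73a_levelHalf` except that `g` may be supported (apart from `∅`) on
vectors with all components `> ν` and sum `≤ 1/2` — the CLOSED half-space of (7.1), p. 27: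
`𝒢₁(P) = {x ∈ 𝒵 : xᵢ ≥ ν ∀ i, |x| + ψ(x) ≤ γ}` with `ψ ≡ 0`, `γ = 1/2`; cf. p. 47, where the optimiser of
Theorem 2.7 (b) is `g(x) = −𝟙(x ≤ 1/2)`.  The strict variant above is implied by this one
(`FordMaynard2024_thm73a_levelHalf_of_le`) but is VACUOUS for `ν < 1/4` (its hypotheses contradict each other at
`x = (1/2, 1/2)`: `Cruxes/FMThm73aLevelHalf/Lines/closed_point.lean`, 2026-08-31); this is the usable form.
[cite: FordMaynard2024PrimeSieves, Theorem 7.3 (a) (with (7.1), Definitions 7.1–7.2, Lemma 8.4)] -/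
def FordMaynard2024_thm73a_levelHalf_le : Prop :=
  ∀ ν : ℝ, 0 < ν → ν < 1 / 4 →
    ∀ g : VecFn, g.IsSymmetric → IsPiecewiseConstOnCone g →
      (∀ e : Fin 0 → ℝ, g 0 e = 1) →
      (∀ (k : ℕ) (x : Fin k → ℝ), g k x ≠ 0 → k = 0 ∨ ((∀ i, ν < x i) ∧ ∑ i, x i ≤ 1 / 2)) →
      (∀ k : ℕ, 2 ≤ k → ∀ x : Fin k → ℝ, (∀ i, ν < x i ∧ x i < 1 - ν) → ∑ i, x i = 1 →
          starSum g k x ≤ 0) →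
        ∀ c : ℝ, c < sieveBoundG1 ν g → IsLowerSieveConst (1 / 2) 0 ν c

/-- How the fact is consumed: a `g` meeting the hypotheses with `V(ν, g) > 0` gives a positive admissible
constant (`C⁻(1/2, 0, ν) > 0`). [cite: FordMaynard2024PrimeSieves, Theorem 7.3 (a) (use in the proof of Theorem 2.7 (b), §8)] -/
theorem FordMaynard2024_thm73a_levelHalf_le.exists_pos (h : FordMaynard2024_thm73a_levelHalf_le)
    {ν : ℝ} (hν : 0 < ν) (hν4 : ν < 1 / 4) {g : VecFn} (hs : g.IsSymmetric)
    (hpc : IsPiecewiseConstOnCone g) (h0 : ∀ e : Fin 0 → ℝ, g 0 e = 1)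
    (hsupp : ∀ (k : ℕ) (x : Fin k → ℝ), g k x ≠ 0 → k = 0 ∨ ((∀ i, ν < x i) ∧ ∑ i, x i ≤ 1 / 2))
    (hH : ∀ k : ℕ, 2 ≤ k → ∀ x : Fin k → ℝ, (∀ i, ν < x i ∧ x i < 1 - ν) → ∑ i, x i = 1 →
      starSum g k x ≤ 0)
    (hV : 0 < sieveBoundG1 ν g) :
    ∃ c : ℝ, 0 < c ∧ IsLowerSieveConst (1 / 2) 0 ν c :=
  ⟨sieveBoundG1 ν g / 2, by linarith, h ν hν hν4 g hs hpc h0 hsupp hH _ (by linarith)⟩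

/-- The printed-clause fact implies the strict-clause variant (whose support hypothesis is stronger).
[cite: FordMaynard2024PrimeSieves, Theorem 7.3 (a)] -/
theorem FordMaynard2024_thm73a_levelHalf_of_le (h : FordMaynard2024_thm73a_levelHalf_le) :
    FordMaynard2024_thm73a_levelHalf := by
  intro ν hν hν4 g hs hpc h0 hsupp hH c hc
  exact h ν hν hν4 g hs hpc h0 (fun k x hx => (hsupp k x hx).imp_right fun hh => ⟨hh.1, hh.2.le⟩) hH c hc

/-! ### Lemma 8.4, the inclusion `ℋ(P) ⊆ {…}` (PROVED) — why the fact above is implied by the printed theorem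

For `P = (1/2, 0, ν)` the hypothesis of `FordMaynard2024_thm73a_levelHalf` asks `(𝟙⋆g)(x) ≤ 0` on the
explicit set `S = {dim ≥ 2, |x| = 1, ν < xᵢ < 1 − ν}` and integrates over `S`; Lemma 8.4 says
`ℋ(P) = {dim ≥ 2, |x| = 1, xᵢ ∈ (ν, 1 − 2ν) ∪ (2ν, 1 − ν)} ⊆ S` (with equality for `ν < 1/4`). The
inclusion `ℋ(P) ⊆ S` — proved here over the tree's `InCoagFundRegion` (Definition 4.5) — is exactly what
makes the fact WEAKER than Theorem 7.3 (a): the hypothesis on `S` implies the printed hypothesis on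
`ℋ(P)`, and the extra region `S ∖ ℋ(P)` (empty for `ν < 1/4`) only contributes `(𝟙⋆g)/∏xᵢ ≤ 0` to the
bound, so `sieveBoundG1 ν g ≤` the printed right-hand side. -/

/-- **Lemma 8.4 (inclusion direction), over the tree's `𝒞(ℛ)`**: for `P = (1/2, 0, ν)` (any real `ν`; the
source has `0 < ν ≤ 1/3`), every
`x ∈ 𝒞(ℛ(P))` of dimension `k ≥ 2` has all components in `(ν, 1 − 2ν) ∪ (2ν, 1 − ν)` (and `|x| = 1`,
`InCoagFundRegion.sum_eq_one`). Proof as printed: `ℛ(P)` is the set of vectors with components in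
`(ν, 1/2)` summing to `1` (so of dimension `≥ 3`); a component of `x` made of one component of the
fragmenting `ℛ`-vector is `< 1 − 2ν` because the other blocks hold at least two components `> ν`; a
component made of two or more is `> 2ν`, and `< 1 − ν` because another block exists.
[cite: FordMaynard2024PrimeSieves, Lemma 8.4 (the inclusion ℋ(P) ⊆ {…})] -/
theorem FordMaynard2024_lemma84_subset {ν : ℝ} {k : ℕ} (hk : 2 ≤ k) {x : Fin k → ℝ}
    (hx : InCoagFundRegion (1 / 2) 0 ν k x) (j : Fin k) :
    (ν < x j ∧ x j < 1 - 2 * ν) ∨ (2 * ν < x j ∧ x j < 1 - ν) := by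
  classical
  obtain ⟨n, z, ⟨hzb, hzs, hzn⟩, c, hc, hxz⟩ := hx
  -- the fragmenting vector has at least three components, each `> ν`
  have hn : 3 ≤ n := by
    by_contra hlt
    rcases Nat.eq_zero_or_pos n with h0 | hpos
    · subst h0
      simp at hzs
    · haveI : Nonempty (Fin n) := ⟨⟨0, hpos⟩⟩
      have hlt' : ∑ i, z i < ∑ _i : Fin n, (1 - 1 / 2 : ℝ) :=
        Finset.sum_lt_sum_of_nonempty Finset.univ_nonempty fun i _ => (hzb i).2
      rw [Finset.sum_const, Finset.card_univ, Fintype.card_fin, nsmul_eq_mul, hzs] at hlt'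
      have : (n : ℝ) ≤ 2 := by exact_mod_cast (show n ≤ 2 by omega)
      linarith
  have hzν : ∀ i, ν < z i := by
    intro i
    have hne : ({i} : Finset (Fin n)) ≠ Finset.univ := by
      intro h
      have := congrArg Finset.card h
      rw [Finset.card_singleton, Finset.card_univ, Fintype.card_fin] at this
      omega
    rcases hzn {i} (Finset.singleton_nonempty i) hne with h | h
    · rw [Finset.sum_singleton] at h; linarith [(hzb i).1]
    · rw [Finset.sum_singleton] at h; linarith
  -- blocks
  set A : Finset (Fin n) := Finset.univ.filter (fun i => c i = j) with hA
  set B : Finset (Fin n) := Finset.univ.filter (fun i => ¬ c i = j) with hB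
  have hxj : x j = ∑ i ∈ A, z i := hxz j
  have hsumAB : ∑ i ∈ A, z i + ∑ i ∈ B, z i = 1 := by
    rw [hA, hB, Finset.sum_filter_add_sum_filter_not, hzs]
  have hcardAB : A.card + B.card = n := by
    rw [hA, hB, Finset.card_filter_add_card_filter_not, Finset.card_univ, Fintype.card_fin]
  haveI : Nontrivial (Fin k) := Fin.nontrivial_iff_two_le.mpr hk
  obtain ⟨j', hj'⟩ := exists_ne j
  obtain ⟨i₀, hi₀⟩ := hc j
  obtain ⟨i₁, hi₁⟩ := hc j'
  have hi₀A : i₀ ∈ A := by simp [hA, hi₀]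
  have hi₁B : i₁ ∈ B := by simp [hB, hi₁, hj']
  have hAne : A.Nonempty := ⟨i₀, hi₀A⟩
  have hBne : B.Nonempty := ⟨i₁, hi₁B⟩
  have hAnu : A ≠ Finset.univ := by
    intro h
    have : i₁ ∈ A := h ▸ Finset.mem_univ i₁
    simp [hA, hi₁, hj'] at this
  have hBnu : B ≠ Finset.univ := by
    intro h
    have : i₀ ∈ B := h ▸ Finset.mem_univ i₀
    simp [hB, hi₀] at this
  -- no proper subsum in `[0, ν]`: both block sums exceed `ν`
  have hposA : 0 < ∑ i ∈ A, z i := Finset.sum_pos (fun i _ => (hzb i).1) hAne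
  have hposB : 0 < ∑ i ∈ B, z i := Finset.sum_pos (fun i _ => (hzb i).1) hBne
  have hνA : ν < ∑ i ∈ A, z i := by
    rcases hzn A hAne hAnu with h | h
    · linarith
    · linarith
  have hνB : ν < ∑ i ∈ B, z i := by
    rcases hzn B hBne hBnu with h | h
    · linarith
    · linarith
  -- two distinct members of a block give `> 2ν`
  have htwo : ∀ S : Finset (Fin n), 1 < S.card → 2 * ν < ∑ i ∈ S, z i := by
    intro S hS
    obtain ⟨a, ha, b, hb, hab⟩ := Finset.one_lt_card.1 hS
    have hsub : ({a, b} : Finset (Fin n)) ⊆ S := by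
      intro i hi
      rcases Finset.mem_insert.1 hi with rfl | hi
      · exact ha
      · rw [Finset.mem_singleton] at hi; rw [hi]; exact hb
    have hle : ∑ i ∈ ({a, b} : Finset (Fin n)), z i ≤ ∑ i ∈ S, z i :=
      Finset.sum_le_sum_of_subset_of_nonneg hsub fun i _ _ => (hzb i).1.le
    rw [Finset.sum_pair hab] at hle
    linarith [hzν a, hzν b]
  by_cases hA1 : A.card = 1
  · left
    have hB2 : 1 < B.card := by omega
    have := htwo B hB2
    refine ⟨by rw [hxj]; exact hνA, ?_⟩
    rw [hxj]; linarith
  · right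
    have hA2 : 1 < A.card := by
      have := hAne.card_pos
      omega
    have := htwo A hA2
    refine ⟨by rw [hxj]; exact this, ?_⟩
    rw [hxj]; linarith

/-- Consequently `ℋ(P) ⊆ S = {ν < xᵢ < 1 − ν}` — the set on which `FordMaynard2024_thm73a_levelHalf` places
its hypothesis and its integral. [cite: FordMaynard2024PrimeSieves, Lemma 8.4] -/
theorem FordMaynard2024_lemma84_subset' {ν : ℝ} (hν : 0 < ν) {k : ℕ} (hk : 2 ≤ k) {x : Fin k → ℝ}
    (hx : InCoagFundRegion (1 / 2) 0 ν k x) (j : Fin k) : ν < x j ∧ x j < 1 - ν := by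
  rcases FordMaynard2024_lemma84_subset hk hx j with ⟨h1, h2⟩ | ⟨h1, h2⟩
  · exact ⟨h1, by linarith⟩
  · exact ⟨by linarith, h2⟩

end Literature.NumberTheory.Sieve.FordMaynard

end
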